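import Summits.CriticalPhenomena.SAWScalingLimit.Theses.SAWCircleScreening

/-!
# Birth skeleton (`Lines/birth.lean`) for crux `NoDeepReturn` (stmt-CriticalPhenomena-5464)

Route `SAWCircleScreening` of `CriticalPhenomena/SAWScalingLimit`, crux r4 `NoDeepReturn` (S3 of
the card `circle-bridge-screening`): for every `ε > 0` there is `M ≥ 4` such that, uniformly over
Jordan far geometry `D` flat in `B(c, Mρ)` (half-disc through `c`, or the full disc when `u = 0`),
near data `K ⊆ B̄(c, ρ)`, mesh `0 < δ`, `2δ ≤ ρ`, start `a` within `ρ` of `c`, target `b` beyond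
`Mρ`, `a, b` joined in `(D ∖ K)_δ`:
`P^{x_c-SAW((D∖K)_δ; a, b)}(∃ i < i', |δγ_i − c| ≥ Mρ ∧ |δγ_{i'} − c| < 3ρ) ≤ ε`
— after first reaching distance `Mρ` the critical walk does not come back within `3ρ` of `c`.

## The line: Kemppainen–Smirnov Condition G3 for the critical SAW, OBSERVED AT FIRST-EXIT TIMES

A deep return is the composite of (i) the walk up to its FIRST EXIT from `B(c, R)`, `R = Mρ/2`, and
(ii) a PENETRATION of the continuation from the sphere `|z − c| ≈ R` back into `B(c, 3ρ)`.
Conditioning the `x_c^{|γ|}`-weighted chordal law on the prefix up to a stopping index is exact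
(domain Markov: the continuation is the critical SAW of the domain minus the prefix, tree theorem
`Theorems.ScreeningRecursion.law_markov`), and at a FIRST-EXIT time the conditioned configuration
stays in a clean uniformity class: all removed data (`K` and the prefix) lie INSIDE `B(c, R)`, the
tip is just outside, the collar `B(c, 2R) ∖ B(c, R)` is flat and untouched, `b` is beyond `2R`.
In Kemppainen–Smirnov's language (arXiv:1212.6215, Def. 2.2 and Conditions G2/G3, p. 9) the
penetration observed at a first-exit time is automatically UNFORCED (the flat collar joins the tip
to `b` around the ball), so no "avoidable component" bookkeeping is needed; by contrast,
conditioning at inward re-entry times (the literal G2 ⇒ G3 chain of KS §2.2, p. 11) meets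
self-made traps (the past pinching its own outward strand seals a pocket and FORCES the next inward
crossing), which is why the cut is made at exit times only and the whole modulus decay is carried
by ONE penetration statement.

Vocabulary (§1): `flatModel c u` (the crux's inlined half-plane/plane set, verbatim),
`Penetrates c s γ` (the walk enters the open ball `B(c, s)`), `IsExitConfig Ω c u δ R x b` (the
EXIT CLASS: any bounded `Ω ⊆ ℂ` — not only `D ∖ K`, so that the class contains the honest
conditional laws after the largest-component repair — flat on the collar, `Ω ∩ B(c,R)` inside the
half-plane, `6δ ≤ R`, start `R ≤ |δx − c| < R + δ`, target beyond `2R`, joined), and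
`PenetrationBound L η` (uniformly over the exit class, `P(enter B(c,s)) ≤ η` whenever
`6δ ≤ s ≤ R/L`).

* `stub_penetrationDecay : ExitPenetrationDecay` (XL, LOAD-BEARING) — `∀ ε > 0 ∃ L ≥ 1,
  PenetrationBound L ε`: a critical SAW released on the sphere of a ball that contains ALL the
  near data (arbitrary), with a flat collar of modulus 2 and a far target, comes within `s` of the
  centre with probability `≤ ε` once `R ≥ L s` (and `s ≥ 6δ` keeps the inner ball super-lattice).
  KS Condition G3 for the critical `ℤ²` SAW restricted to annuli concentric at `c` and to
  first-exit observation times; heuristic exponents `(s/R)^{2/3}` (interior, `2 − d_SAW`) and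
  `(s/R)^{2}` (boundary point; SLE_{8/3} boundary proximity). Not in print for SAW (no RSW/FKG).
* `stub_exitMarkov : ExitMarkovReduction` (L) — for crux data with `M ≥ 6` and ANY `s, η`: a
  uniform bound `η` on `P(enter B(c,s))` over the exit configurations at `R = Mρ/2` with the same
  centre, half-plane, mesh and target bounds `P(after reaching distance Mρ/2, enter B(c,s)) ≤ η`
  for the walk from `a`. Mechanism: sum the domain Markov identity over the prefixes up to the
  first exit index of `B(c, Mρ/2)` (`law_markov`, `markov_identity`, `exit_spec`,
  `prefix_fiber_eq_cylinder` of `Theorems/SAWCircleScreeningScreeningRecursion*.lean`) and check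
  that each conditioned configuration — after deleting the mesh points of the competing
  (non-tip) components of `(D ∖ K')_δ` of size ≥ the tip's component, none of which meets the flat
  collar — is an exit configuration (tip distance in `[R, R+δ)` by one lattice step; `K ∪ prefix ⊆
  B(c,R)`; collar flat from `D ∩ B(c,Mρ)` flat; `b` beyond `Mρ = 2R`; reachability along the
  continuation).
* PROVED (no `sorry`): `deepReturn_subset` (the crux event at modulus `M` lies in the
  "after reaching `Mρ/2`, enter `B(c,3ρ)`" event), `penetrationBound_one` (sanity: the bound at
  level `1` holds for every `L`, all junk cases included — the definitions compute), and the
  composition `NoDeepReturn_of` (`ε ↦ L` by A, `M := 6L ≥ 6`, B at `s = 3ρ`, `η = ε`, its premise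
  discharged by A since `6δ ≤ 3ρ` and `L · 3ρ ≤ 6Lρ/2`), concluding the route decl BY NAME.

## Disproof / negatives used
* `Cruxes/NoDeepReturn/Disproof.lean`: none exists (`ledger crux ls stmt-CriticalPhenomena-5464`:
  "no workfiles yet", 2026-08-17) — no `_false_without_` obstruction to honour, no landed
  `Theorems/NoDeepReturn/Negative/*`.
* `ledger negatives --problem CriticalPhenomena`: the only SAW-law entry (stmt-0772, `IsTightLaws`
  over ALL `δ ∈ (0,1]`, far coincident endpoints) is avoided in kind — both stubs are fixed-`δ`
  uniform statements over configurations that carry their own non-degeneracy (`Reachable`,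
  `6δ ≤ s`, `6δ ≤ R`), no tightness over a `δ`-range is asserted.
* Vacuity / junk pass: `SAW.law` is the junk measure `0` only without walks (excluded by
  `Reachable`) or with infinite total weight (excluded by `Bornology.IsBounded`); a zero measure
  satisfies every bound anyway, so junk members never falsify A or B. The inner radius of A is
  pinned super-lattice (`6δ ≤ s`): with a sub-lattice inner ball the event "visit the site nearest
  to `c`" has `L`-independent positive probability and A would be false — this is why A pushes the
  START radius out (`R ≥ L s`) instead of shrinking the inner ball. B holds for every real `s, η`
  (for `η < 0` both sides vanish by the same Markov identity).
-/

noncomputable section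

open scoped BigOperators Topology Classical MeasureTheory ENNReal NNReal
open Filter Set TopologicalSpace MeasureTheory
open Literature.Probability.RandomPlanarGeometry Literature.Probability.LatticeModels

namespace Summit.CriticalPhenomena.SAWScalingLimit.Cruxes.NoDeepReturn.Birth

/-! ### 1. Vocabulary -/

/-- The FLAT MODEL at `c` with normal datum `u`: the open half-plane `{z | 0 < Im((z − c)·u)}`
through `c`, or the whole plane when `u = 0` (interior centre).  VERBATIM the crux's inlined set
`{z | u = 0 ∨ 0 < ((z - c) * u).im}`. -/
def flatModel (c u : ℂ) : Set ℂ := {z | u = 0 ∨ 0 < ((z - c) * u).im}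

/-- PENETRATION to depth `s`: the walk visits a vertex whose mesh point lies in the open ball
`B(c, s)`. -/
def Penetrates {Ω : Set ℂ} {δ : ℝ} {x b : Site 2} (c : ℂ) (s : ℝ) (γ : SAW.DomainSAW Ω δ x b) :
    Prop :=
  ∃ i ≤ γ.walk.length, dist (meshPoint δ (γ.walk.getVert i)) c < s

/-- The EXIT CLASS at centre `c`, half-plane datum `u`, mesh `δ`, data radius `R`: an ARBITRARY
bounded set `Ω ⊆ ℂ` (not only `D ∖ K`: the class must contain the honest conditional laws after
the largest-component repair), FLAT on the collar `B(c, 2R) ∖ B(c, R)` (there `Ω` is exactly the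
flat model) and contained in the flat model inside `B(c, R)` (where it is otherwise arbitrary:
this is where the near data and the past live), `6δ ≤ R`, a start `x` just outside the data ball
(`R ≤ |δx − c| < R + δ`, one lattice step past the sphere), a target `b` beyond `2R`, and `x, b`
joined in `Ω_δ` (so `SAW.law Ω δ x b` is an honest probability law). -/
def IsExitConfig (Ω : Set ℂ) (c u : ℂ) (δ R : ℝ) (x b : Site 2) : Prop :=
  Bornology.IsBounded Ω ∧ 0 < δ ∧ 6 * δ ≤ R ∧
    Ω ∩ (Metric.ball c (2 * R) \ Metric.ball c R) =
      flatModel c u ∩ (Metric.ball c (2 * R) \ Metric.ball c R) ∧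
    Ω ∩ Metric.ball c R ⊆ flatModel c u ∧
    R ≤ dist (meshPoint δ x) c ∧ dist (meshPoint δ x) c < R + δ ∧
    2 * R ≤ dist (meshPoint δ b) c ∧
    (discreteDomainGraph Ω δ).Reachable x b

/-- UNIFORM PENETRATION BOUND at relative depth `1/L` and level `η`: for every exit configuration
and every inner radius `s` with `6δ ≤ s` and `L s ≤ R`, the critical SAW from `x` to `b` enters
`B(c, s)` with law-probability at most `η`. -/
def PenetrationBound (L η : ℝ) : Prop :=
  ∀ (Ω : Set ℂ) (c u : ℂ) (δ R : ℝ) (x b : Site 2), IsExitConfig Ω c u δ R x b →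
    ∀ s : ℝ, 6 * δ ≤ s → L * s ≤ R →
      SAW.law Ω δ x b {γ | Penetrates c s γ} ≤ ENNReal.ofReal η

/-- STUB A statement — **exit-time penetration decay** (KS Condition G3 for the critical SAW,
annuli concentric at `c`, observed at first-exit times): `∀ ε > 0 ∃ L ≥ 1, PenetrationBound L ε`.
-/
def ExitPenetrationDecay : Prop :=
  ∀ ε : ℝ, 0 < ε → ∃ L : ℝ, 1 ≤ L ∧ PenetrationBound L ε

/-- STUB B statement — **exit-time Markov reduction**: for crux data `(D, K, c, u, δ, ρ, a, b)`
with modulus `M ≥ 6` (flat in `B(c, Mρ)`, `K ⊆ B̄(c,ρ)`, `2δ ≤ ρ`, start within `ρ`, target beyond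
`Mρ`, joined) and ANY `s, η`: if every exit configuration at data radius `R = Mρ/2` with the same
centre, half-plane datum, mesh and target gives `P(enter B(c,s)) ≤ η`, then
`P(after reaching distance Mρ/2, enter B(c,s)) ≤ η` for the walk from `a` to `b` in `(D ∖ K)_δ`. -/
def ExitMarkovReduction : Prop :=
  ∀ (D : JordanDomain) (K : Set ℂ) (c u : ℂ) (δ ρ M s η : ℝ) (a b : Site 2),
    0 < δ → 2 * δ ≤ ρ → 6 ≤ M → K ⊆ Metric.closedBall c ρ →
    D.carrier ∩ Metric.ball c (M * ρ) = flatModel c u ∩ Metric.ball c (M * ρ) →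
    dist (meshPoint δ a) c ≤ ρ → M * ρ ≤ dist (meshPoint δ b) c →
    (discreteDomainGraph (D.carrier \ K) δ).Reachable a b →
    (∀ (Ω : Set ℂ) (x : Site 2), IsExitConfig Ω c u δ (M * ρ / 2) x b →
      SAW.law Ω δ x b {γ | Penetrates c s γ} ≤ ENNReal.ofReal η) →
    SAW.law (D.carrier \ K) δ a b
      {γ | ∃ i i' : ℕ, i < i' ∧ i' ≤ γ.walk.length ∧
        M * ρ / 2 ≤ dist (meshPoint δ (γ.walk.getVert i)) c ∧
        dist (meshPoint δ (γ.walk.getVert i')) c < s} ≤ ENNReal.ofReal η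

/-! ### 2. The registered stubs (the only `sorry`s of the file) -/

/-- STUB A (XL, LOAD-BEARING): exit-time penetration decay for the critical square-lattice SAW. -/
theorem stub_penetrationDecay : ExitPenetrationDecay := by
  sorry

/-- STUB B (L): exit-time domain-Markov reduction with class closure (largest-component repair
included). -/
theorem stub_exitMarkov : ExitMarkovReduction := by
  sorry

/-! ### Name-keyed aliases of the stub statements (hypotheses of the composition)

`Registered.stub_X : Prop` is the statement of `stub_X` under the registered stub's short name, so
that the skeleton audit (`#h21_check_skeleton`: hypotheses admissible iff registered stubs BY NAME)
accepts `NoDeepReturn_of : Registered.stub_… → … → NoDeepReturn` (device of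
`Cruxes/BoundaryMixing/Lines/birth.lean`). -/
namespace Registered

/-- Alias keyed by the registered stub name. -/
abbrev stub_penetrationDecay : Prop := ExitPenetrationDecay
/-- Alias keyed by the registered stub name. -/
abbrev stub_exitMarkov : Prop := ExitMarkovReduction

end Registered

/-! ### 3. The sorry-free part -/

/-- **Sanity (definitions compute, all junk cases included):** the penetration bound at level `1`
holds at every relative depth — `SAW.law` never charges an event more than `1`. -/
theorem penetrationBound_one (L : ℝ) : PenetrationBound L 1 := by
  intro Ω c u δ R x b _ s _ _
  rw [ENNReal.ofReal_one, SAW.law, Measure.smul_apply, smul_eq_mul]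
  calc (SAW.weight Ω δ x b Set.univ)⁻¹ * SAW.weight Ω δ x b {γ | Penetrates c s γ}
      ≤ (SAW.weight Ω δ x b Set.univ)⁻¹ * SAW.weight Ω δ x b Set.univ := by
        gcongr; exact Set.subset_univ _
    _ ≤ 1 := ENNReal.inv_mul_le_one _

/-- `PenetrationBound` is monotone in the level. -/
theorem PenetrationBound.mono {L η η' : ℝ} (h : PenetrationBound L η) (hη : η ≤ η') :
    PenetrationBound L η' :=
  fun Ω c u δ R x b hcfg s hs hLs => (h Ω c u δ R x b hcfg s hs hLs).trans (ENNReal.ofReal_le_ofReal hη)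

/-- `PenetrationBound` is monotone in the relative depth: a larger `L` asks less. -/
theorem PenetrationBound.anti {L L' η : ℝ} (h : PenetrationBound L η) (hL : L ≤ L') :
    PenetrationBound L' η := by
  intro Ω c u δ R x b hcfg s hs hLs
  have hs0 : 0 ≤ s := le_trans (by linarith [hcfg.2.1.le]) hs
  exact h Ω c u δ R x b hcfg s hs (le_trans (mul_le_mul_of_nonneg_right hL hs0) hLs)

/-- **The crux event sits inside the reduction event:** a deep return at modulus `M` (reach `Mρ`,
then enter `B(c, 3ρ)`) in particular reaches `Mρ/2` before entering `B(c, 3ρ)` (`ρ ≥ 0`,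
`M ≥ 0`). -/
theorem deepReturn_subset {Ω : Set ℂ} {δ ρ M : ℝ} {c : ℂ} {a b : Site 2} (hρ : 0 ≤ ρ)
    (hM : 0 ≤ M) :
    {γ : SAW.DomainSAW Ω δ a b | ∃ i i' : ℕ, i < i' ∧ i' ≤ γ.walk.length ∧
        M * ρ ≤ dist (meshPoint δ (γ.walk.getVert i)) c ∧
        dist (meshPoint δ (γ.walk.getVert i')) c < 3 * ρ} ⊆
      {γ | ∃ i i' : ℕ, i < i' ∧ i' ≤ γ.walk.length ∧
        M * ρ / 2 ≤ dist (meshPoint δ (γ.walk.getVert i)) c ∧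
        dist (meshPoint δ (γ.walk.getVert i')) c < 3 * ρ} := by
  rintro γ ⟨i, i', hii', hi', hfar, hnear⟩
  refine ⟨i, i', hii', hi', le_trans ?_ hfar, hnear⟩
  have : 0 ≤ M * ρ := mul_nonneg hM hρ
  linarith

/-- **The composition in vocabulary form** (no `sorry`): exit-time penetration decay and the
exit-time Markov reduction give the crux, with `M = 6L`. -/
theorem noDeepReturn_of_decay_of_markov (hA : ExitPenetrationDecay) (hB : ExitMarkovReduction) :
    Summit.CriticalPhenomena.SAWScalingLimit.Theses.SAWCircleScreening.NoDeepReturn := by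
  intro ε hε
  obtain ⟨L, hL, hPB⟩ := hA ε hε
  refine ⟨6 * L, by linarith, ?_⟩
  intro D K c u δ ρ a b hδ hδρ hK hflat ha hb hreach
  have hM : (6 : ℝ) ≤ 6 * L := by linarith
  have hρ : 0 ≤ ρ := by linarith
  -- the class bound at data radius `R = Mρ/2 = 3Lρ` and depth `s = 3ρ`, from stub A
  have hclass : ∀ (Ω : Set ℂ) (x : Site 2), IsExitConfig Ω c u δ (6 * L * ρ / 2) x b →
      SAW.law Ω δ x b {γ | Penetrates c (3 * ρ) γ} ≤ ENNReal.ofReal ε := by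
    intro Ω x hcfg
    exact hPB Ω c u δ (6 * L * ρ / 2) x b hcfg (3 * ρ) (by linarith) (le_of_eq (by ring))
  -- stub B at `s = 3ρ`, `η = ε`
  have key := hB D K c u δ ρ (6 * L) (3 * ρ) ε a b hδ hδρ hM hK hflat ha hb hreach hclass
  exact le_trans (measure_mono (deepReturn_subset hρ (by linarith))) key

/-- **The composition (kernel-checked, no `sorry`)**: the two registered stubs imply the crux
`NoDeepReturn` BY NAME. -/
theorem NoDeepReturn_of (hA : Registered.stub_penetrationDecay) (hB : Registered.stub_exitMarkov) :
    Summit.CriticalPhenomena.SAWScalingLimit.Theses.SAWCircleScreening.NoDeepReturn :=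
  noDeepReturn_of_decay_of_markov hA hB

/-- Wiring check: the registered stubs feed `NoDeepReturn_of` as stated. -/
example : Summit.CriticalPhenomena.SAWScalingLimit.Theses.SAWCircleScreening.NoDeepReturn :=
  NoDeepReturn_of stub_penetrationDecay stub_exitMarkov

end Summit.CriticalPhenomena.SAWScalingLimit.Cruxes.NoDeepReturn.Birth

end
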